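import Mathlib
import Summits.KontsevichZagierPeriods.KontsevichZagierPeriods.Theorems.TorsionLogsGKZLevelThreePairBetaCubic
import HarnessLib

/-!
# `BetaLinearSector` (stmt-KontsevichZagierPeriods-3897), line `fermat-sector-transport` —
# stub `stub_betaFold_duplication` (Legendre's duplication in linear form, step 2)

The LEVEL-4 rung (`a, b, a', b' ∈ ¼ℤ`) of the crux `BetaLinearSector` (route FermatIsogeny) needs
the within-class coincidence `B(a,a) = 2^{1-2a} · B(a,1/2)` (Legendre's duplication formula in
linear form) realised INSIDE the Kontsevich–Zagier calculus of moves.  After folding the symmetric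
cell `[(0,1), x^{a-1}(1-x)^{a-1}]` onto the half interval (step 1, the neighbouring stub
`stub_betaSymm_fold`), THIS file performs step 2, ONE polynomial change of variables (rule (2) of
[Kontsevich–Zagier 2001, §1.2]):

* source `h = [(0,1/2), 2·x^{a-1}(1-x)^{a-1}]`;
* map `u = Φ(x) = 4x(1-x)` from `(0,1/2)` onto `(0,1)` (`Φ' = 4(1-2x) > 0`, `Φ(0) = 0`,
  `Φ(1/2) = 1`; the inverse branch is `x = (1 - √(1-u))/2`);
* target `d = [(0,1), 2^{1-2a}·u^{a-1}(1-u)^{-1/2}]`.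

Pull-back check (`betaDup_pullback`): `1 - Φ(x) = (1-2x)²`, so `(1-Φ)^{-1/2} = (1-2x)⁻¹`;
`Φ^{a-1} = 4^{a-1} x^{a-1} (1-x)^{a-1}`; `2^{1-2a}·4^{a-1} = 2^{-1}`; hence
`d.integrand (Φ x) · |Φ' x| = ½ · x^{a-1}(1-x)^{a-1} · (1-2x)⁻¹ · 4(1-2x) = 2·x^{a-1}(1-x)^{a-1}`,
the integrand of `h`.  Both representations are given (pinned by domain and integrand); only the
relation `[h] − [d] ∈ KZ.relations` is produced, through the one-dimensional packaging
`of_sub_of_mem_changeOfVariablesRel_dimOne` of rule (2).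

References: M. Kontsevich, D. Zagier, *Periods* (2001), §1.2 rule (2); G. E. Andrews, R. Askey,
R. Roy, *Special Functions* (1999), Thm. 1.5.1 (Legendre duplication) and (1.5.4).
-/

noncomputable section

namespace Summit.KontsevichZagierPeriods.FermatIsogeny.BetaLinearSector.Quarters

open Set MeasureTheory
open MvPolynomial (aeval X C)
open Literature.NumberTheory.Transcendental Literature.NumberTheory.Transcendental.KZ
open Summit.KontsevichZagierPeriods.HermiteRigidity.CMTwistQuasiPeriodTransfer
  (of_sub_of_mem_changeOfVariablesRel_dimOne)
open Summit.KontsevichZagierPeriods.KontsevichZagierPeriods.Theorems.GKZLevelThree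
  (isSemialgebraicFunOn_ratFun₁)

/-! ## The substitution `u = 4x(1-x)` on `(0, 1/2)` -/

/-- The derivative of `Φ(x) = 4x(1-x)` is `4(1-2x)`. -/
theorem betaDup_hasDerivAt (x : ℝ) :
    HasDerivAt (fun x : ℝ => 4 * x * (1 - x)) (4 * (1 - 2 * x)) x := by
  have h1 : HasDerivAt (fun x : ℝ => 4 * x) 4 x := by
    simpa using (hasDerivAt_id x).const_mul (4:ℝ)
  have h2 : HasDerivAt (fun x : ℝ => 1 - x) (-1) x := by
    simpa using (hasDerivAt_id x).const_sub (1:ℝ)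
  exact (h1.mul h2).congr_deriv (by ring)

/-- `1 - 4x(1-x) = (1-2x)²`. -/
theorem betaDup_one_sub (x : ℝ) : 1 - 4 * x * (1 - x) = (1 - 2 * x) ^ 2 := by ring

/-- `Φ = 4x(1-x)` is injective on `{x < 1/2}`: `Φ p = Φ q` forces `(p-q)(1-p-q) = 0`. -/
theorem betaDup_inj {p q : ℝ} (hp : p < 1 / 2) (hq : q < 1 / 2)
    (h : 4 * p * (1 - p) = 4 * q * (1 - q)) : p = q := by
  have h1 : (p - q) * (4 * (1 - p - q)) = 0 := by linear_combination h
  rcases mul_eq_zero.1 h1 with h2 | h2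
  · linarith
  · linarith

/-- `Φ` maps `(0, 1/2)` into `(0, 1)` (`1 - Φ(x) = (1-2x)² > 0`). -/
theorem betaDup_mem_Ioo {x : ℝ} (h0 : 0 < x) (h1 : x < 1 / 2) :
    4 * x * (1 - x) ∈ Ioo (0:ℝ) 1 := by
  have h1x : 0 < 1 - x := by linarith
  have h2x : 0 < 1 - 2 * x := by linarith
  refine ⟨by positivity, ?_⟩
  rw [← sub_pos, betaDup_one_sub]
  positivity

/-- `Φ` maps `(0, 1/2)` ONTO `(0, 1)`: `u ∈ (0,1)` is `Φ((1 - √(1-u))/2)`. -/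
theorem betaDup_image :
    (fun x : ℝ => 4 * x * (1 - x)) '' {x : ℝ | 0 < x ∧ x < 1 / 2} = Ioo 0 1 := by
  apply Subset.antisymm
  · rintro _ ⟨x, hx, rfl⟩
    exact betaDup_mem_Ioo hx.1 hx.2
  · intro u hu
    have hu1 : 0 < 1 - u := by linarith [hu.2]
    have hs0 : 0 < Real.sqrt (1 - u) := Real.sqrt_pos.2 hu1
    have hs1 : Real.sqrt (1 - u) < 1 := by
      rw [Real.sqrt_lt' one_pos]
      linarith [hu.1]
    have hsq : Real.sqrt (1 - u) ^ 2 = 1 - u := Real.sq_sqrt hu1.le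
    refine ⟨(1 - Real.sqrt (1 - u)) / 2, ⟨by linarith, by linarith⟩, ?_⟩
    show 4 * ((1 - Real.sqrt (1 - u)) / 2) * (1 - (1 - Real.sqrt (1 - u)) / 2) = u
    linear_combination (-1:ℝ) * hsq

/-! ## The pull-back identity -/

/-- The constant bookkeeping of the duplication formula: `2^{1-2a} · 4^{a-1} = 1/2`. -/
theorem betaDup_const (a : ℝ) : (2:ℝ) ^ (1 - 2 * a) * (4:ℝ) ^ (a - 1) = 1 / 2 := by
  rw [show (4:ℝ) = (2:ℝ) ^ (2:ℝ) by rw [Real.rpow_two]; norm_num, ← Real.rpow_mul zero_le_two,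
    ← Real.rpow_add two_pos, show (1 - 2 * a + 2 * (a - 1) : ℝ) = -1 by ring, Real.rpow_neg_one]
  norm_num

/-- The pull-back identity of step 2: for `0 < x < 1/2` and `u = 4x(1-x)`,
`2^{1-2a} · (u^{a-1} (1-u)^{-1/2}) · |4(1-2x)| = 2 · (x^{a-1} (1-x)^{a-1})`. -/
theorem betaDup_pullback {a x : ℝ} (hx0 : 0 < x) (hx1 : x < 1 / 2) :
    (2:ℝ) ^ (1 - 2 * a) * ((4 * x * (1 - x)) ^ (a - 1) * (1 - 4 * x * (1 - x)) ^ (-(1:ℝ) / 2)) *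
        |4 * (1 - 2 * x)| = 2 * (x ^ (a - 1) * (1 - x) ^ (a - 1)) := by
  have h1x : 0 < 1 - x := by linarith
  have h2x : 0 < 1 - 2 * x := by linarith
  -- `Φ^{a-1} = 4^{a-1} x^{a-1} (1-x)^{a-1}`
  have hA : (4 * x * (1 - x)) ^ (a - 1) = (4:ℝ) ^ (a - 1) * x ^ (a - 1) * (1 - x) ^ (a - 1) := by
    rw [Real.mul_rpow (by positivity) h1x.le, Real.mul_rpow (by norm_num) hx0.le]
  -- `(1 - Φ)^{-1/2} = ((1-2x)²)^{-1/2} = (1-2x)⁻¹`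
  have hB : (1 - 4 * x * (1 - x)) ^ (-(1:ℝ) / 2) = (1 - 2 * x)⁻¹ := by
    rw [betaDup_one_sub, show ((1 - 2 * x) ^ 2 : ℝ) = (1 - 2 * x) ^ (2:ℝ) by norm_cast,
      ← Real.rpow_mul h2x.le, show (2 * (-(1:ℝ) / 2) : ℝ) = -1 by norm_num, Real.rpow_neg_one]
  have hinv : (1 - 2 * x)⁻¹ * (4 * (1 - 2 * x)) = 4 := by
    field_simp
  have hc := betaDup_const a
  rw [hA, hB, abs_of_pos (by positivity : (0:ℝ) < 4 * (1 - 2 * x))]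
  calc (2:ℝ) ^ (1 - 2 * a) * ((4:ℝ) ^ (a - 1) * x ^ (a - 1) * (1 - x) ^ (a - 1) * (1 - 2 * x)⁻¹) *
        (4 * (1 - 2 * x))
      = ((2:ℝ) ^ (1 - 2 * a) * (4:ℝ) ^ (a - 1)) * (x ^ (a - 1) * (1 - x) ^ (a - 1)) *
          ((1 - 2 * x)⁻¹ * (4 * (1 - 2 * x))) := by ring
    _ = 2 * (x ^ (a - 1) * (1 - x) ^ (a - 1)) := by
        rw [hc, hinv]
        ring

/-! ## Step 2 of the duplication chain -/

/-- **Legendre duplication, step 2, as ONE change of variables.**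
`[(0,1/2), 2·x^{a-1}(1-x)^{a-1}] ∼ [(0,1), 2^{1-2a}·u^{a-1}(1-u)^{-1/2}]` by rule (2) of the
Kontsevich–Zagier calculus along `u = 4x(1-x)`: `ℚ`-polynomial, injective on `(0,1/2)` with image
`(0,1)`, derivative `4(1-2x)`, and the pull-back identity `betaDup_pullback`.
[cite: KontsevichZagier2001, §1.2 rule (2)] -/
theorem stub_betaFold_duplication : ∀ a : ℚ, 0 < a → ∀ (h d : KZ.IntegralRep 1),
    h.domain = {x | 0 < x 0 ∧ x 0 < 1 / 2} →
    Set.EqOn h.integrand (fun x => 2 * ((x 0) ^ ((a:ℝ) - 1) * (1 - x 0) ^ ((a:ℝ) - 1))) h.domain →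
    d.domain = {x | x 0 ∈ Set.Ioo (0:ℝ) 1} →
    Set.EqOn d.integrand
      (fun x => (2:ℝ) ^ (1 - 2 * (a:ℝ)) * ((x 0) ^ ((a:ℝ) - 1) * (1 - x 0) ^ (-(1:ℝ) / 2)))
      d.domain →
    KZ.Equivalent h d := by
  intro a _ h d hhd hhi hdd hdi
  set φ : ℝ → ℝ := fun x => 4 * x * (1 - x) with hφ
  set φ' : ℝ → ℝ := fun x => 4 * (1 - 2 * x) with hφ'
  refine changeOfVariablesRel_subset_relations
    (of_sub_of_mem_changeOfVariablesRel_dimOne h d φ φ' ?_ (fun p _ => betaDup_hasDerivAt (p 0))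
      ?_ ?_ ?_)
  · -- `Φ` is a `ℚ`-polynomial, hence `ℚ`-semialgebraic on the domain
    refine isSemialgebraicFunOn_ratFun₁ h.isSemialgebraic_domain (C 4 * X 0 * (1 - X 0)) 1 φ
      (fun x _ => by simp) (fun x _ => ?_)
    simp [hφ]
  · -- injectivity on `(0, 1/2)`
    intro p hp q hq hpq
    rw [hhd] at hp hq
    exact betaDup_inj hp.2 hq.2 hpq
  · -- the image is `(0, 1)`
    rw [hdd, hhd]
    ext y
    simp only [mem_setOf_eq, mem_image]
    constructor
    · intro hy
      have : y 0 ∈ φ '' {x : ℝ | 0 < x ∧ x < 1 / 2} := by rw [betaDup_image]; exact hy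
      obtain ⟨w, hw, hwy⟩ := this
      exact ⟨fun _ => w, hw, funext fun i => by rw [Subsingleton.elim i 0]; exact hwy⟩
    · rintro ⟨p, hp, rfl⟩
      exact betaDup_mem_Ioo hp.1 hp.2
  · -- the pull-back identity on the domain
    intro p hp
    have hp' : 0 < p 0 ∧ p 0 < 1 / 2 := by rw [hhd] at hp; exact hp
    have hφp : (fun _ : Fin 1 => φ (p 0)) ∈ d.domain := by
      rw [hdd]
      exact betaDup_mem_Ioo hp'.1 hp'.2
    rw [hhi hp, hdi hφp]
    exact (betaDup_pullback hp'.1 hp'.2).symm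

end Summit.KontsevichZagierPeriods.FermatIsogeny.BetaLinearSector.Quarters

end
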